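import Summits.NavierStokesRegularity.NavierStokesRegularity.Theorems.FrequencyRigidity.Negative.FrequencyStructure
import Literature.Analysis.FluidPDE.AdaptedBackwardKernel
import Literature.Analysis.FluidPDE.SelfSimilar
import Literature.Analysis.FluidPDE.TaoEnstrophyLocalisation
import HarnessLib.Audit

/-!
# Line `two-ended-pinning` — crux `FrequencyRigidity` (stmt-NavierStokesRegularity-2955), route `AdaptedFrequency`

CRUX-PLAN skeleton (planner `cruxplan-stmt-NavierStokesRegularity-2955-two-ended-pinning`, round 1; idea card
`Cruxes/FrequencyRigidity/Ideas/two-ended-pinning.md`, triage TRIAGE-r1-{1,2,3}: pass ×3).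

The crux `FrequencyRigidity = ¬ ∃ (ν C Λ₀ v q K), …` forbids a smooth ancient Navier–Stokes flow on
`ℝ³ × (−∞,0)` with the GLOBAL Type-I bound `‖v(t)‖∞ ≤ C/√(−t)`, an adapted two-sided Gaussian-comparable
kernel `K` at `(0,0)`, positive adapted enstrophy `H(t) = ∫ ‖curl v(t)‖² K(t)` and CONSTANT adapted frequency
`Λ(t) = (−t)H′/H ≡ Λ₀`.

THE LEVER (idea card; already a CHECKED theorem of the standing disprover, landed as
`Theorems/FrequencyRigidity/Negative/FrequencyStructure.lean`: `FreqClause.power_law`,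
`FreqClause.exponent_eq_two` — imported here, not re-proved): constant `Λ` integrates to the exact power law
`H(t) = H(−1)(−t)^{−Λ₀}`, and the two-ended Type-I ENSTROPHY bound `H(t) ≤ M(−t)^{−2}` (both ends
`t ↑ 0` and `t → −∞`) PINS the exponent: `Λ₀ = 2`, i.e. `t² H(t) ≡ A > 0` — the witness reproduces the
backward-self-similar enstrophy law on the nose.  What the lever needs and the crux does not literally
supply are its two inputs, which are the first two stubs (shared by every line on this crux, triage G1/G6):

* `stub_scaleInvariantBounds` (M–L): classical + GLOBAL time-Type-I on `(−∞,0)` ⇒ the scale-invariant KNSS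
  derivative bounds `‖Dᵏv(t)‖∞ ≤ C'_k (−t)^{−(k+1)/2}`, `k ≥ 1`, constants depending on `(ν, C, k)` only
  (KNSS 2009 §4 on windows + parabolic/viscosity rescaling; derivatives of order `≥ 1` are blind to the
  Galilei wobble `U(x − B(t), t) + B′(t)`).  Gives the enstrophy bound with `M = (‖curlCLM‖ C'_1)²` (proved
  below, `adaptedEnstrophy_le_of_bounds`, unit mass of `K`).
* `stub_enstrophyFirstVariation` (L): the KERNEL CALCULUS — `H ∈ C¹(−∞,0)` with the transport-free first
  variation `H′(t) = 2 ∫ (⟪ω, Dv ω⟫ − ν |∇ω|²_F) K` (cut-off, adjoint equation of `K`, `div v = 0`, vorticity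
  equation; only the Gaussian UPPER bound of `K` is used).  Its differentiability half is the `hd` of
  `FreqClause.exponent_eq_two` (load-bearing: at `Λ₀ = 0` Mathlib's junk `deriv` would otherwise bite).
* `stub_flatEnstrophyLiouville` (XL, HARDEST — the card's Transfer `C⁺` in normal form): there is NO
  "flat inhabitant": a classical ancient flow with the global Type-I bound, the scale-invariant bounds, an
  adapted comparable kernel, and `H(t) = A(−t)^{−2}` EXACTLY with `A > 0` (plus, for self-containedness, the
  first-variation clause).  `C⁺` is invariant under the full parabolic scaling group about `(0,0)` and closed
  under local smooth limits with the SAME constants (blow-down/blow-up tangent flows keep `A`), which the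
  `Λ ≡ Λ₀` form is not before pinning.  Honest residual (card §(3), triage S1/G2): steady-in-similarity
  inhabitants are dead (Tsai `q = ∞`, in tree `tsai_selfsimilar_bounded_holds`); bounded-profile backward
  ROTATED self-similar flows (Perelman/RSS) with their co-rotating invariant density ARE flat inhabitants
  identically, so this stub contains RSS-Liouville for every `α` in the bounded class — dead for `|α| ≪ 1`,
  `|α| ≫ 1` in the decaying class (Pineau–Vicol 2026 Thm 1.4, `pineauVicol2026_rss_liouville`), OPEN on the
  window `α ≈ 1` (their Conj. 1.1 = Bradshaw–Tsai 2017 OP 5.2).  The crux is PV-window-hard and so is this stub.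

COMPOSITION `FrequencyRigidity_of` (real proof): unbundle the crux (`Negative.frequencyRigidity_iff`) →
stub 1 → stub 2 (`hd`) → `adaptedEnstrophy_le_of_bounds` (`hM`) → `FreqClause.exponent_eq_two` (`Λ₀ = 2`) →
`FreqClause.power_law` (flat law, `A = H(−1) > 0` by the positivity clause) → stub 3.

DISPROOF USED (`Cruxes/FrequencyRigidity/Disproof.lean`, cdisprove v3, NO KILL; landed twins under
`Theorems/FrequencyRigidity/Negative/`): (A) `frequencyRigidity_false_without_posH` — positivity is used in
the composition (`A = H(−1) > 0`) and is clause (vii) of `IsFlatInhabitant`; (B)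
`frequencyRigidity_false_without_typeI` / `_false_with_local_typeI` (rigid rotation, `Λ ≡ 0`) — the GLOBAL
bound is used twice: by `stub_scaleInvariantBounds` (whole-space KNSS windows; rigid rotation has `‖Dv‖ ≡ 1`,
not `O((−t)^{−1})` as `t → −∞`) and at the ancient end of the pinning (`Λ₀ ≥ 2`); (C)
`frequencyRigidity_false_without_momentum` (kinematic self-similar swirl, `Λ ≡ 2`, `H = A/t²`) — confronted,
not dodged: the swirl satisfies every clause of `IsFlatInhabitant` except the momentum equation, so
`stub_flatEnstrophyLiouville` must use the Navier–Stokes dynamics (as its docstring says); (T) is imported.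
`ledger negatives --problem NavierStokesRegularity` (2 entries: stmt-4055, stmt-0154) — unrelated; no stub
restates either.
-/

noncomputable section

set_option linter.dupNamespace false

namespace Summit.NavierStokesRegularity.NavierStokesRegularity.Cruxes.FrequencyRigidity.TwoEndedPinning

open Literature.Analysis.FluidPDE MeasureTheory Set Filter Topology Function
open scoped RealInnerProductSpace Laplacian ContDiff

/-- Physical space `ℝ³`. -/
abbrev E3 := EuclideanSpace ℝ (Fin 3)

/-! ## Vocabulary of the line -/

/-- **Scale-invariant (KNSS) derivative bounds** of an ancient field on `(−∞,0)`:
`‖Dᵏ v(t, x)‖ ≤ C'_k · (−t)^{−(k+1)/2}` for every order `k ≥ 1`, every `t < 0` and every `x`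
(the Type-I bound itself is the case `k = 0`, kept separately as `HasTypeITimeDecay`). -/
def ScaleInvariantBounds (C' : ℕ → ℝ) (v : ℝ → E3 → E3) : Prop :=
  ∀ k : ℕ, 1 ≤ k → ∀ t < 0, ∀ x, ‖iteratedFDeriv ℝ k (v t) x‖ ≤ C' k * (-t) ^ (-((k : ℝ) + 1) / 2)

/-- **The transport-free first-variation density** of the adapted enstrophy:
`2 (⟪ω, Dv ω⟫ − ν |∇ω|²_F)` with `ω = curl v(t)`, `Dv ω = (ω·∇)v` the stretching term and
`|∇ω|²_F = ∑ᵢ ‖∂ᵢ ω‖²` the Frobenius norm (`frobeniusNormSq`).  (`⟪ω, Dv ω⟫ = ⟪ω, S ω⟫`, `S` the strain.) -/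
def firstVariationDensity (ν : ℝ) (v : ℝ → E3 → E3) (t : ℝ) (x : E3) : ℝ :=
  2 * (⟪curl (v t) x, fderiv ℝ (v t) x (curl (v t) x)⟫ - ν * frobeniusNormSq (fderiv ℝ (curl (v t)) x))

/-- **A FLAT INHABITANT** — the pinned normal form of a witness against the crux (the card's `C⁺`):
(i) `0 < ν`; (ii) `(v, q)` classical Navier–Stokes on `ℝ³ × (−∞,0)`; (iii) the GLOBAL time-Type-I bound
`‖v(t,x)‖ ≤ C/√(−t)`; (iv) the scale-invariant derivative bounds (output of `stub_scaleInvariantBounds`);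
(v) `K` an adapted backward kernel of `∂ₜ + v·∇ − νΔ` on `(−∞,0)` with pole `(0,0)` (the crux's five
clauses, `isAdaptedBackwardKernel_iff`); (vi) two-sided Gaussian comparability
(`isGaussianComparable_iff_fin_three`); (vii) `0 < A`; (viii) the EXACT self-similar enstrophy law
`H(t) = A (−t)^{−2}` for all `t < 0` (pinning); (ix) `H ∈ C¹` with the transport-free first variation
(output of `stub_enstrophyFirstVariation`; with (viii) it gives the instantaneous law
`∫ (⟪ω, Dv ω⟫ − ν|∇ω|²_F) K = A (−t)^{−3}` at EVERY `t < 0`).  Clauses (iv), (ix) are consequences of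
the others; they are carried so that the Liouville stub is self-contained. -/
def IsFlatInhabitant (ν C A : ℝ) (C' : ℕ → ℝ) (v : ℝ → E3 → E3) (q : ℝ → E3 → ℝ)
    (K : ℝ → E3 → ℝ) : Prop :=
  0 < ν ∧ IsClassicalNSSolutionOn (Iio 0) ν 0 v q ∧ HasTypeITimeDecay C v ∧
    ScaleInvariantBounds C' v ∧ IsAdaptedBackwardKernel ν v (Iio 0) 0 0 K ∧
    IsGaussianComparable K (Iio 0) 0 0 ∧ 0 < A ∧
    (∀ t < 0, adaptedEnstrophy v K t = A * (-t) ^ (-(2 : ℝ))) ∧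
    (∀ t < 0, HasDerivAt (adaptedEnstrophy v K) (∫ x, firstVariationDensity ν v t x * K t x) t)

/-! ## The stubs (v2 — lead's reshape, 2026-08-16)

Each stub's statement is the `Prop` `Sig.stub_<name>` (its SIGNATURE, written over TREE declarations only,
fully qualified, so that a worker's landed `Theorems/` file can state it verbatim) and the registered
obligation is `theorem stub_<name> : Sig.stub_<name> := by sorry`.  The lead's reshape splits the planner's
two provable stubs into worker-sized pieces without touching the composition idea:

* planner's `stub_scaleInvariantBounds`  =  `stub_unitTimeDerivBounds` (KNSS window bound at the unit time
  `t = −1`, all orders, constants uniform in the Type-I class)  +  `stub_scaleInvariantBounds_of_unitTime`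
  (viscosity + parabolic rescaling transfer to every `t < 0`; pure bookkeeping);
* planner's `stub_enstrophyFirstVariation`  =  `stub_vorticitySqTransport` (pointwise transport identity
  `(∂ₜ + v·∇ − νΔ)‖ω‖² = 2⟪ω, Dv ω⟫ − 2ν|∇ω|²_F`, the vorticity equation of the tree)  +  `stub_kernelPairing`
  (generic kernel calculus `d/dt ∫ φK = ∫ (∂ₜφ + v·∇φ − νΔφ)K` for a jointly smooth `φ` with locally uniform
  bounds, against an adapted Gaussian-comparable kernel — cut-off, adjoint clause, IBP, `R → ∞`)  +
  `stub_vorticitySqBounds` (`φ = ‖curl v‖²` is jointly smooth and has those bounds under the scale-invariant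
  bounds);
* `stub_flatEnstrophyLiouville` unchanged (held by the lead).

The planner's two signatures survive below as DERIVED `Prop`s (`Sig.stub_scaleInvariantBounds`,
`Sig.stub_enstrophyFirstVariation`) with in-file proofs from the new stubs (`scaleInvariantBounds_of`,
`enstrophyFirstVariation_of`), and `FrequencyRigidity_of` consumes the six registered stubs BY NAME. -/

/-- Planner's Stub 1 (now DERIVED from `stub_unitTimeDerivBounds` + `stub_scaleInvariantBounds_of_unitTime`):
scale-invariant derivative bounds, constants uniform in the Type-I class. [cite: KochNadirashviliSereginSverak2009, §4] -/
def Sig.stub_scaleInvariantBounds : Prop :=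
  ∀ ν C : ℝ, 0 < ν → ∃ C' : ℕ → ℝ,
    ∀ (v : ℝ → E3 → E3) (q : ℝ → E3 → ℝ),
      IsClassicalNSSolutionOn (Iio 0) ν 0 v q → HasTypeITimeDecay C v → ScaleInvariantBounds C' v

/-- Planner's Stub 2 (now DERIVED from `stub_vorticitySqTransport` + `stub_kernelPairing` +
`stub_vorticitySqBounds`): the transport-free first variation of the adapted enstrophy. [cite: Poon1996, §2] -/
def Sig.stub_enstrophyFirstVariation : Prop :=
  ∀ (ν C : ℝ) (C' : ℕ → ℝ) (v : ℝ → E3 → E3) (q : ℝ → E3 → ℝ) (K : ℝ → E3 → ℝ), 0 < ν →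
    IsClassicalNSSolutionOn (Iio 0) ν 0 v q → HasTypeITimeDecay C v → ScaleInvariantBounds C' v →
    IsAdaptedBackwardKernel ν v (Iio 0) 0 0 K → IsGaussianComparable K (Iio 0) 0 0 →
    ∀ t < 0, HasDerivAt (adaptedEnstrophy v K) (∫ x, firstVariationDensity ν v t x * K t x) t

/-- **Stub 1a — KNSS window bound at the unit time (size M–L).**  For every Type-I constant `C` there
are constants `C'_k` such that every classical Navier–Stokes flow `(u, p)` with viscosity `1` on
`ℝ³ × (−∞,0)` with the GLOBAL time-Type-I bound `‖u(t,x)‖ ≤ C/√(−t)` obeys `‖Dᵏu(−1, x)‖ ≤ C'_k` for all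
`k ≥ 1` and all `x`.  Why true / how: on the window `t ∈ (−3, −⅛)` the flow is bounded by `3C`, hence a
bounded weak solution there (`IsClassicalNSSolutionOn.isBoundedWeakNSSolutionOn`, time-translated by
`comp_add_right` as in `ChaeWolfRemovingDSSBounds.exists_uniform_lipschitz`); the PROVED tree theorem
`KNSS2009_regularity_boundedWeak_window_holds` gives `u = U + b(t)` a.e. with `‖DᵏU‖ ≤ C(k, δ)` on
`(δ, T)`; derivatives of order `≥ 1` do not see `b`, so `Dᵏu(τ,·) = DᵏU(τ,·)` at a.e. `τ` (slices are
continuous: `Continuous.ae_eq_iff_eq`), and the a.e.-in-`τ` bound upgrades to EVERY `τ` (in particular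
`τ ↦ −1`) by continuity of `τ ↦ Dᵏu(τ, x)` (`IsSmoothSpaceTimeOn.hasDerivAt_iteratedFDeriv_slice`) and
`ChaeWolf.le_of_ae_le_of_continuousOn`.  Uses the GLOBAL bound (Disproof (B): rigid rotation is not
bounded). [cite: KochNadirashviliSereginSverak2009, §4 (4.10) and proof of Thm 5.2 first sentence] -/
def Sig.stub_unitTimeDerivBounds : Prop :=
  ∀ C : ℝ, ∃ C' : ℕ → ℝ,
    ∀ (u : ℝ → EuclideanSpace ℝ (Fin 3) → EuclideanSpace ℝ (Fin 3))
      (p : ℝ → EuclideanSpace ℝ (Fin 3) → ℝ),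
      Literature.Analysis.FluidPDE.IsClassicalNSSolutionOn (Set.Iio 0) 1 0 u p →
      Literature.Analysis.FluidPDE.HasTypeITimeDecay C u →
      ∀ k : ℕ, 1 ≤ k → ∀ x : EuclideanSpace ℝ (Fin 3), ‖iteratedFDeriv ℝ k (u (-1)) x‖ ≤ C' k

/-- **Stub 1b — rescaling transfer (size M, pure bookkeeping).**  The unit-time bound of Stub 1a (for
EVERY Type-I constant) implies the scale-invariant bounds `‖Dᵏv(t,x)‖ ≤ C'_k (−t)^{−(k+1)/2}` for every
classical flow with ANY viscosity `ν > 0` and the time-Type-I bound, with constants depending on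
`(ν, C, k)` only.  How: viscosity rescaling `u(s,x) = ν⁻¹ v(ν⁻¹ s, x)` is classical with viscosity `1` on
`(−∞,0)` (`IsClassicalNSSolutionOn.viscosityRescale_set` with `S = S' = Iio 0`, `timeRescale`) and
Type-I with constant `C/√ν`; for `s₀ < 0` the parabolic rescaling `nsRescale λ u`, `λ = √(−s₀)`
(`IsClassicalNSSolutionOn.nsRescale_holds`, preimage of `Iio 0` is `Iio 0`; `HasTypeITimeDecay.nsRescale`,
SAME constant) has `(nsRescale λ u)(−1, y) = λ u(s₀, λ y)`, so
`Dᵏ(nsRescale λ u (−1))(y) = λ^{k+1} (Dᵏu(s₀))(λ y)` (chain rule for a homothety, e.g.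
`ContinuousLinearMap.iteratedFDeriv_comp_right` / `iteratedFDeriv_comp_smul`-type lemmas, cf. the tree's
`norm_iteratedFDeriv_comp_smul_le`, `TaoQuantitativeReduction.norm_iteratedFDeriv_nsRescaleData_le`), whence
`‖Dᵏu(s₀, x)‖ ≤ C'_k (−s₀)^{−(k+1)/2}` and `Dᵏv(t) = ν Dᵏu(νt)`. [cite: KochNadirashviliSereginSverak2009, §1 (scaling) and §4] -/
def Sig.stub_scaleInvariantBounds_of_unitTime : Prop :=
  (∀ C : ℝ, ∃ C' : ℕ → ℝ,
    ∀ (u : ℝ → EuclideanSpace ℝ (Fin 3) → EuclideanSpace ℝ (Fin 3))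
      (p : ℝ → EuclideanSpace ℝ (Fin 3) → ℝ),
      Literature.Analysis.FluidPDE.IsClassicalNSSolutionOn (Set.Iio 0) 1 0 u p →
      Literature.Analysis.FluidPDE.HasTypeITimeDecay C u →
      ∀ k : ℕ, 1 ≤ k → ∀ x : EuclideanSpace ℝ (Fin 3), ‖iteratedFDeriv ℝ k (u (-1)) x‖ ≤ C' k) →
  ∀ ν C : ℝ, 0 < ν → ∃ C' : ℕ → ℝ,
    ∀ (v : ℝ → EuclideanSpace ℝ (Fin 3) → EuclideanSpace ℝ (Fin 3))
      (q : ℝ → EuclideanSpace ℝ (Fin 3) → ℝ),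
      Literature.Analysis.FluidPDE.IsClassicalNSSolutionOn (Set.Iio 0) ν 0 v q →
      Literature.Analysis.FluidPDE.HasTypeITimeDecay C v →
      ∀ k : ℕ, 1 ≤ k → ∀ t : ℝ, t < 0 → ∀ x : EuclideanSpace ℝ (Fin 3),
        ‖iteratedFDeriv ℝ k (v t) x‖ ≤ C' k * (-t) ^ (-((k : ℝ) + 1) / 2)

/-- **Stub 2a — transport identity for `‖ω‖²` (size M).**  For a classical Navier–Stokes flow `(v, q)`
(any viscosity `ν`, zero force) on `ℝ³ × (−∞,0)` and `ω = curl v`, pointwise at every `t < 0`, `x`: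
`∂ₜ‖ω‖² + D(‖ω‖²)·v − νΔ‖ω‖² = 2(⟪ω, Dv ω⟫ − ν|Dω|²_F)`.  How: `∂ₜ‖ω‖² = 2⟪ω, ∂ₜω⟫` with
`∂ₜω = curl ∂ₜv` (`IsSmoothSpaceTimeOn.timeDerivWithin_vorticity_eq` / `hasDerivAt_fderiv_slice_clm`; on the
open set `Iio 0` the within-derivative is `deriv`, `IsSmoothSpaceTimeOn.timeDerivWithin_eq`), the tree's
vorticity equation `IsClassicalNSSolutionOn.curl_timeDerivWithin_eq`
(`curl ∂ₜv = νΔω − (v·∇)ω + (ω·∇)v`, `convect`), `D‖ω‖²·v = 2⟪ω, Dω v⟫` (`fderiv` of `‖·‖²`), and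
`Δ‖ω‖² = 2⟪Δω, ω⟫ + 2|Dω|²_F` (`laplacian_inner_self_eq`, `real_inner_self_eq_norm_sq`). [cite: MajdaBertozziCUP2002, §1.1 (1.33); Tao2011, (10.18)] -/
def Sig.stub_vorticitySqTransport : Prop :=
  ∀ (ν : ℝ) (v : ℝ → EuclideanSpace ℝ (Fin 3) → EuclideanSpace ℝ (Fin 3))
    (q : ℝ → EuclideanSpace ℝ (Fin 3) → ℝ),
    Literature.Analysis.FluidPDE.IsClassicalNSSolutionOn (Set.Iio 0) ν 0 v q →
    ∀ t : ℝ, t < 0 → ∀ x : EuclideanSpace ℝ (Fin 3),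
      deriv (fun s => ‖Literature.Analysis.FluidPDE.curl (v s) x‖ ^ 2) t
          + fderiv ℝ (fun y => ‖Literature.Analysis.FluidPDE.curl (v t) y‖ ^ 2) x (v t x)
          - ν * Laplacian.laplacian (fun y => ‖Literature.Analysis.FluidPDE.curl (v t) y‖ ^ 2) x =
        2 * (inner ℝ (Literature.Analysis.FluidPDE.curl (v t) x)
                (fderiv ℝ (v t) x (Literature.Analysis.FluidPDE.curl (v t) x))
              - ν * Literature.Analysis.FluidPDE.frobeniusNormSq
                (fderiv ℝ (Literature.Analysis.FluidPDE.curl (v t)) x))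

/-- **Stub 2b — kernel pairing (size L; the analytic heart of the planner's Stub 2, pure kernel
calculus, no Navier–Stokes).**  Let `v` be jointly smooth on `(−∞,0) × ℝ³`, divergence free, with the
time-Type-I bound; `K` an adapted backward kernel of `∂ₜ + v·∇ − νΔ` on `(−∞,0)` at `(0,0)`
(`C²`, `> 0`, `∂ₜK + DK·v + νΔK = 0`, unit mass, concentration) which is two-sided Gaussian-comparable;
`φ` a jointly smooth scalar field whose value, gradient, Laplacian and time derivative are bounded on
every compact time interval `[a,b] ⊂ (−∞,0)`, uniformly in `x`.  Then `t ↦ ∫ φ(t)K(t)` is differentiable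
at every `t < 0` with derivative `∫ (∂ₜφ + Dφ·v − νΔφ) K` — transport drops out exactly.  How: for a
smooth cut-off `χ_R(x) = χ(‖x‖²/R²)` differentiate `∫ φχ_R K` under the integral
(`hasDerivAt_integral_of_dominated_loc_of_deriv_le`, compact `x`-support, `∂ₜK` continuous), substitute the
adjoint clause `∂ₜK = −DK·v − νΔK`, integrate by parts on compact support (`div v = 0`; Green's second
identity for the Laplacian — tree `WholeSpaceIBP` / Mathlib `integral_mul_deriv_eq_deriv_mul`-type lemmas)
to get `d/dt ∫ φχ_R K = ∫ (∂ₜ(φχ_R) + D(φχ_R)·v − νΔ(φχ_R)) K`; then `R → ∞`: `∫ φχ_R K → ∫ φK` pointwise and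
the derivatives converge LOCALLY UNIFORMLY in `t` (errors `≲ B ∫ (1 − χ_R)K + (B(1 + C/√(−b)) / R) ∫ K`
with the Gaussian UPPER bound `K ≤ C₁(−b)^{−3/2} e^{−‖x‖²/(C₂(−a))}` on `[a,b]`), and
`hasDerivAt_of_tendstoLocallyUniformlyOn` concludes. [cite: Friedman1964, Ch. 1 §8 (adjoint operator); ConstantinIyer2007, §2] -/
def Sig.stub_kernelPairing : Prop :=
  ∀ (ν C : ℝ) (v : ℝ → EuclideanSpace ℝ (Fin 3) → EuclideanSpace ℝ (Fin 3))
    (K φ : ℝ → EuclideanSpace ℝ (Fin 3) → ℝ),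
    Literature.Analysis.FluidPDE.IsSmoothSpaceTimeOn (Set.Iio 0) v →
    (∀ t ∈ Set.Iio (0 : ℝ), Literature.Analysis.FluidPDE.VectorCalculus.IsDivFree (v t)) →
    Literature.Analysis.FluidPDE.HasTypeITimeDecay C v →
    Literature.Analysis.FluidPDE.IsAdaptedBackwardKernel ν v (Set.Iio 0) 0 0 K →
    Literature.Analysis.FluidPDE.IsGaussianComparable K (Set.Iio 0) 0 0 →
    Literature.Analysis.FluidPDE.IsSmoothSpaceTimeOn (Set.Iio 0) φ →
    (∀ a b : ℝ, a < b → b < 0 → ∃ B : ℝ, ∀ t ∈ Set.Icc a b, ∀ x : EuclideanSpace ℝ (Fin 3),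
        |φ t x| ≤ B ∧ ‖fderiv ℝ (φ t) x‖ ≤ B ∧ |Laplacian.laplacian (φ t) x| ≤ B ∧
          |deriv (fun s => φ s x) t| ≤ B) →
    ∀ t : ℝ, t < 0 →
      HasDerivAt (fun s => ∫ x, φ s x * K s x)
        (∫ x, (deriv (fun s => φ s x) t + fderiv ℝ (φ t) x (v t x)
                - ν * Laplacian.laplacian (φ t) x) * K t x) t

/-- **Stub 2c — bounds for `‖ω‖²` (size M).**  Under the classical hypotheses, the time-Type-I bound and
the scale-invariant derivative bounds of all orders `k ≥ 1`, the scalar field `φ(t,x) = ‖curl v(t,x)‖²` is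
jointly smooth on `(−∞,0) × ℝ³` and `φ`, `Dφ`, `Δφ`, `∂ₜφ` are bounded on every `[a,b] ⊂ (−∞,0)` uniformly
in `x` (the hypotheses of Stub 2b for this `φ`).  How: joint smoothness from `IsSmoothSpaceTimeOn` of `v`
(`fderiv_slice_apply`/`clm_comp` with `curlCLM`, `curl_eq_curlCLM`; `‖·‖²` smooth); `‖ω‖ ≤ ‖curlCLM‖‖Dv‖`
(`norm_curl_le`), `‖Dω‖ ≤ ‖curlCLM‖‖D²v‖`, `‖Δω‖ ≤ 3‖D²ω‖ ≲ ‖D³v‖` give `|φ| ≲ (−t)^{−2}`,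
`‖Dφ‖ ≤ 2‖ω‖‖Dω‖`, `|Δφ| ≤ 2‖ω‖‖Δω‖ + 2|Dω|²_F` (`laplacian_inner_self_eq`, `frobeniusNormSq ≤ 3‖·‖²`);
`∂ₜφ = 2⟪ω, ∂ₜω⟫` with `∂ₜω = curl ∂ₜv = νΔω − (v·∇)ω + (ω·∇)v`
(`IsClassicalNSSolutionOn.curl_timeDerivWithin_eq`, `‖v‖ ≤ C/√(−t)`); on `[a,b]` every power of `(−t)` is
bounded. [cite: KochNadirashviliSereginSverak2009, §4 (4.10)] -/
def Sig.stub_vorticitySqBounds : Prop :=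
  ∀ (ν C : ℝ) (C' : ℕ → ℝ) (v : ℝ → EuclideanSpace ℝ (Fin 3) → EuclideanSpace ℝ (Fin 3))
    (q : ℝ → EuclideanSpace ℝ (Fin 3) → ℝ),
    Literature.Analysis.FluidPDE.IsClassicalNSSolutionOn (Set.Iio 0) ν 0 v q →
    Literature.Analysis.FluidPDE.HasTypeITimeDecay C v →
    (∀ k : ℕ, 1 ≤ k → ∀ t : ℝ, t < 0 → ∀ x : EuclideanSpace ℝ (Fin 3),
        ‖iteratedFDeriv ℝ k (v t) x‖ ≤ C' k * (-t) ^ (-((k : ℝ) + 1) / 2)) →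
    Literature.Analysis.FluidPDE.IsSmoothSpaceTimeOn (Set.Iio 0)
        (fun t x => ‖Literature.Analysis.FluidPDE.curl (v t) x‖ ^ 2) ∧
      ∀ a b : ℝ, a < b → b < 0 → ∃ B : ℝ, ∀ t ∈ Set.Icc a b, ∀ x : EuclideanSpace ℝ (Fin 3),
        |‖Literature.Analysis.FluidPDE.curl (v t) x‖ ^ 2| ≤ B ∧
          ‖fderiv ℝ (fun y => ‖Literature.Analysis.FluidPDE.curl (v t) y‖ ^ 2) x‖ ≤ B ∧
          |Laplacian.laplacian (fun y => ‖Literature.Analysis.FluidPDE.curl (v t) y‖ ^ 2) x| ≤ B ∧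
          |deriv (fun s => ‖Literature.Analysis.FluidPDE.curl (v s) x‖ ^ 2) t| ≤ B

/-- **Stub 3 — FLAT-ENSTROPHY LIOUVILLE (the card's Transfer `C⁺`; size XL; the HARDEST stub and the
line's bet; held by the lead).**  There is no flat inhabitant (`IsFlatInhabitant`): no classical ancient Navier–Stokes flow on
`ℝ³ × (−∞,0)` with the global Type-I bound and an adapted comparable kernel at `(0,0)` whose adapted
enstrophy is EXACTLY `A(−t)^{−2}`, `A > 0`.  WHY EASIER than the crux as typed: one algebraic
normalisation instead of an ODE clause with `deriv` junk; invariant under the parabolic scaling group about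
`(0,0)` and closed under local smooth limits with the SAME constants `(ν, C, C', c₁, c₂, C₁, C₂, A)`, so
blow-down (`t → −∞`) and blow-up (`t ↑ 0`) tangent flows, minimal subsets of the translation hull in
`s = −log(−t)` and symmetry reductions are admissible moves; and the instantaneous law
`𝒮(t) − ν𝒫(t) = A(−t)^{−3}` (from (viii)–(ix)) holds at EVERY time.  WHY IT MIGHT FAIL: a bounded backward
ROTATED self-similar profile (`v = pvAnsatz α U₀`, Perelman/RSS) with `α` in Pineau–Vicol's open window
`[α_(C), ᾱ(C)]` and its co-rotating invariant-density kernel is a flat inhabitant (pattern rotation leaves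
`t²H` invariant) — Bradshaw–Tsai 2017 OP 5.2 = Pineau–Vicol 2026 Conj. 1.1; known kills: steady profiles
(`tsai_selfsimilar_bounded_holds`, in tree), `|α| ≪ 1` / `|α| ≫ 1` in the decaying class
(`pineauVicol2026_rss_liouville`, named fact), axisymmetric inhabitants (KNSS Thm 5.3), `C < ε₀√ν`
(Duhamel gap).  Must use the momentum equation (Disproof (C): the kinematic swirl meets every other clause). [cite: BradshawTsai2017CPDE, §5 OP 5.2; PineauVicol2026, Thm 1.4 and Conj. 1.1] -/
def Sig.stub_flatEnstrophyLiouville : Prop :=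
  ∀ (ν C A : ℝ) (C' : ℕ → ℝ) (v : ℝ → E3 → E3) (q : ℝ → E3 → ℝ) (K : ℝ → E3 → ℝ),
    ¬ IsFlatInhabitant ν C A C' v q K

/-! ## Registered stubs (the ONLY `sorry`s of the file) -/

theorem stub_unitTimeDerivBounds : Sig.stub_unitTimeDerivBounds := by
  sorry

theorem stub_scaleInvariantBounds_of_unitTime : Sig.stub_scaleInvariantBounds_of_unitTime := by
  sorry

theorem stub_vorticitySqTransport : Sig.stub_vorticitySqTransport := by
  sorry

theorem stub_kernelPairing : Sig.stub_kernelPairing := by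
  sorry

theorem stub_vorticitySqBounds : Sig.stub_vorticitySqBounds := by
  sorry

theorem stub_flatEnstrophyLiouville : Sig.stub_flatEnstrophyLiouville := by
  sorry

/-! ## Proved glue: the planner's two stubs from the reshaped ones -/

/-- Planner's Stub 1 from Stubs 1a + 1b (definitional unfolding of `ScaleInvariantBounds`). -/
theorem scaleInvariantBounds_of (h1a : Sig.stub_unitTimeDerivBounds)
    (h1b : Sig.stub_scaleInvariantBounds_of_unitTime) : Sig.stub_scaleInvariantBounds := by
  intro ν C hν
  obtain ⟨C', hC'⟩ := h1b h1a ν C hν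
  exact ⟨C', fun v q hNS hTI k hk t ht x => hC' v q hNS hTI k hk t ht x⟩

/-- Planner's Stub 2 from Stubs 2a + 2b + 2c: apply the kernel pairing to `φ = ‖curl v‖²` (its
hypotheses are Stub 2c) and rewrite the integrand pointwise by the transport identity (Stub 2a). -/
theorem enstrophyFirstVariation_of (h2a : Sig.stub_vorticitySqTransport) (h2b : Sig.stub_kernelPairing)
    (h2c : Sig.stub_vorticitySqBounds) : Sig.stub_enstrophyFirstVariation := by
  intro ν C C' v q K _hν hNS hTI hB hK hG t ht
  obtain ⟨hφ, hbd⟩ := h2c ν C C' v q hNS hTI hB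
  have hd := h2b ν C v K (fun t x => ‖curl (v t) x‖ ^ 2) hNS.smooth_velocity hNS.divFree hTI hK hG
    hφ hbd t ht
  have hfun : adaptedEnstrophy v K = fun s => ∫ x, ‖curl (v s) x‖ ^ 2 * K s x := rfl
  have hint : (∫ x, (deriv (fun s => ‖curl (v s) x‖ ^ 2) t
        + fderiv ℝ (fun y => ‖curl (v t) y‖ ^ 2) x (v t x)
        - ν * Laplacian.laplacian (fun y => ‖curl (v t) y‖ ^ 2) x) * K t x) =
      ∫ x, firstVariationDensity ν v t x * K t x := by
    refine integral_congr_ae (Eventually.of_forall fun x => ?_)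
    simp only [firstVariationDensity]
    rw [h2a ν v q hNS t ht x]
  rw [hfun, ← hint]
  exact hd

/-! ## Proved glue: the two-ended enstrophy bound from the scale-invariant bounds -/

/-- `‖curl v(t,x)‖ ≤ ‖curlCLM‖ · C'_1 · (−t)^{−1}` under the scale-invariant bounds (`k = 1`). -/
theorem norm_curl_le_of_bounds {C' : ℕ → ℝ} {v : ℝ → E3 → E3} (hB : ScaleInvariantBounds C' v)
    {t : ℝ} (ht : t < 0) (x : E3) :
    ‖curl (v t) x‖ ≤ ‖curlCLM‖ * C' 1 * (-t) ^ (-(1 : ℝ)) := by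
  have h1 := hB 1 le_rfl t ht x
  rw [norm_iteratedFDeriv_one] at h1
  have h2 : (-(((1 : ℕ) : ℝ) + 1) / 2 : ℝ) = -(1 : ℝ) := by norm_num
  rw [h2] at h1
  calc ‖curl (v t) x‖ ≤ ‖curlCLM‖ * ‖fderiv ℝ (v t) x‖ := norm_curl_le _ _
    _ ≤ ‖curlCLM‖ * (C' 1 * (-t) ^ (-(1 : ℝ))) :=
        mul_le_mul_of_nonneg_left h1 (norm_nonneg curlCLM)
    _ = ‖curlCLM‖ * C' 1 * (-t) ^ (-(1 : ℝ)) := by ring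

/-- **The two-ended Type-I ENSTROPHY bound** `H(t) ≤ (‖curlCLM‖ C'_1)² (−t)^{−2}` for every `t < 0`:
pointwise vorticity bound, positivity and UNIT MASS of the kernel (Gaussian comparability is not needed
for this step, triage G1). -/
theorem adaptedEnstrophy_le_of_bounds {ν : ℝ} {C' : ℕ → ℝ} {v : ℝ → E3 → E3} {K : ℝ → E3 → ℝ}
    (hB : ScaleInvariantBounds C' v) (hK : IsAdaptedBackwardKernel ν v (Iio 0) 0 0 K)
    {t : ℝ} (ht : t < 0) :
    (∫ x, ‖curl (v t) x‖ ^ 2 * K t x) ≤ (‖curlCLM‖ * C' 1) ^ 2 * (-t) ^ (-(2 : ℝ)) := by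
  have hneg : 0 < -t := by linarith
  have ht' : t ∈ Iio (0 : ℝ) := ht
  have hsq : ∀ x, ‖curl (v t) x‖ ^ 2 ≤ (‖curlCLM‖ * C' 1) ^ 2 * (-t) ^ (-(2 : ℝ)) := fun x => by
    have hω := norm_curl_le_of_bounds hB ht x
    have h1 : ‖curl (v t) x‖ ^ 2 ≤ (‖curlCLM‖ * C' 1 * (-t) ^ (-(1 : ℝ))) ^ 2 :=
      pow_le_pow_left₀ (norm_nonneg _) hω 2
    have h2 : ((-t) ^ (-(1 : ℝ))) ^ 2 = (-t) ^ (-(2 : ℝ)) := by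
      rw [← Real.rpow_natCast, ← Real.rpow_mul hneg.le]
      norm_num
    calc ‖curl (v t) x‖ ^ 2 ≤ (‖curlCLM‖ * C' 1 * (-t) ^ (-(1 : ℝ))) ^ 2 := h1
      _ = (‖curlCLM‖ * C' 1) ^ 2 * ((-t) ^ (-(1 : ℝ))) ^ 2 := by ring
      _ = (‖curlCLM‖ * C' 1) ^ 2 * (-t) ^ (-(2 : ℝ)) := by rw [h2]
  have hint : Integrable (fun x => (‖curlCLM‖ * C' 1) ^ 2 * (-t) ^ (-(2 : ℝ)) * K t x) :=
    (hK.integrable ht').const_mul _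
  calc (∫ x, ‖curl (v t) x‖ ^ 2 * K t x)
      ≤ ∫ x, (‖curlCLM‖ * C' 1) ^ 2 * (-t) ^ (-(2 : ℝ)) * K t x :=
        integral_mono_of_nonneg
          (Eventually.of_forall fun x => mul_nonneg (sq_nonneg _) (hK.pos t ht' x).le) hint
          (Eventually.of_forall fun x => mul_le_mul_of_nonneg_right (hsq x) (hK.pos t ht' x).le)
    _ = (‖curlCLM‖ * C' 1) ^ 2 * (-t) ^ (-(2 : ℝ)) := by
        rw [integral_const_mul, hK.integral_eq_one t ht', mul_one]

/-! ## The composition: pinning (imported, checked) + the three stubs ⇒ the crux BY NAME -/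

/-- **The line.**  The six registered stubs imply `FrequencyRigidity`: unbundle a witness; Stubs 1a+1b give
the scale-invariant bounds, Stubs 2a+2b+2c the differentiability of `H`, `adaptedEnstrophy_le_of_bounds` the
two-ended enstrophy bound; the disprover's CHECKED `FreqClause.exponent_eq_two` pins `Λ₀ = 2` and
`FreqClause.power_law` turns the witness into a flat inhabitant with `A = H(−1) > 0` (positivity clause),
which Stub 3 forbids. -/
theorem FrequencyRigidity_of (h1a : Sig.stub_unitTimeDerivBounds)
    (h1b : Sig.stub_scaleInvariantBounds_of_unitTime) (h2a : Sig.stub_vorticitySqTransport)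
    (h2b : Sig.stub_kernelPairing) (h2c : Sig.stub_vorticitySqBounds)
    (h₃ : Sig.stub_flatEnstrophyLiouville) :
    Theses.AdaptedFrequency.FrequencyRigidity := by
  have h₁ : Sig.stub_scaleInvariantBounds := scaleInvariantBounds_of h1a h1b
  have h₂ : Sig.stub_enstrophyFirstVariation := enstrophyFirstVariation_of h2a h2b h2c
  rw [Theorems.FrequencyRigidity.Negative.frequencyRigidity_iff]
  rintro ⟨ν, C, Λ₀, v, q, K, hν, hNS, hTI, hKc, hCmp, hF⟩
  have hTI' : HasTypeITimeDecay C v := fun t ht x => hTI t ht x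
  obtain ⟨hK1, hK2, hK3, hK4, hK5⟩ := hKc
  have hK : IsAdaptedBackwardKernel ν v (Iio 0) 0 0 K := ⟨hK1, hK2, hK3, hK4, hK5⟩
  obtain ⟨c₁, c₂, C₁, C₂, hc₁, hc₂, hC₁, hC₂, hcmp⟩ := hCmp
  have hG : IsGaussianComparable K (Iio 0) 0 0 :=
    isGaussianComparable_iff_fin_three.2 ⟨c₁, c₂, C₁, C₂, hc₁, hc₂, hC₁, hC₂, hcmp⟩
  obtain ⟨C', hC'⟩ := h₁ ν C hν
  have hB : ScaleInvariantBounds C' v := hC' v q hNS hTI'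
  have hFV := h₂ ν C C' v q K hν hNS hTI' hB hK hG
  have hd : ∀ t < 0, DifferentiableAt ℝ (fun t => ∫ x, ‖curl (v t) x‖ ^ 2 * K t x) t :=
    fun t ht => (hFV t ht).differentiableAt
  have hM : ∀ t < 0, (∫ x, ‖curl (v t) x‖ ^ 2 * K t x) ≤
      (‖curlCLM‖ * C' 1) ^ 2 * (-t) ^ (-(2 : ℝ)) :=
    fun t ht => adaptedEnstrophy_le_of_bounds hB hK ht
  have hΛ : Λ₀ = 2 := hF.exponent_eq_two hd hM
  refine h₃ ν C (∫ x, ‖curl (v (-1)) x‖ ^ 2 * K (-1) x) C' v q K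
    ⟨hν, hNS, hTI', hB, hK, hG, ?_, ?_, hFV⟩
  · exact (hF _ _ rfl rfl).1 (-1) (by norm_num)
  · intro t ht
    rw [adaptedEnstrophy_apply, hF.power_law hd ht, hΛ]

/-- The skeleton instantiated: the crux modulo the three registered stubs. -/
theorem FrequencyRigidity_skeleton : Theses.AdaptedFrequency.FrequencyRigidity :=
  FrequencyRigidity_of stub_unitTimeDerivBounds stub_scaleInvariantBounds_of_unitTime
    stub_vorticitySqTransport stub_kernelPairing stub_vorticitySqBounds stub_flatEnstrophyLiouville

end Summit.NavierStokesRegularity.NavierStokesRegularity.Cruxes.FrequencyRigidity.TwoEndedPinning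

end
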